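import Summits.HodgeConjecture.HodgeConjecture.Theorems.LinearSystemTorelliLocalTubeSpanOrbitSpan
import Summits.HodgeConjecture.HodgeConjecture.Theorems.LinearSystemTorelliLocalTubeSpanSaturation
import Summits.HodgeConjecture.HodgeConjecture.Theorems.LinearSystemTorelliLocalTubeSpanTransvections

/-!
# Route LinearSystemTorelli — crux `LocalTubeSpan` (stmt-HodgeConjecture-2490): elements of a transvection group (frame-lift basics)

Helper file (`--supports stmt-HodgeConjecture-2490`, line `Sketch` of the crux chain, cycle 6,
continuation lead c5; basics for the lead's stub `stub_frameLift`, file `…FrameLift`).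

For the monodromy group `Γ_S = transvectionGroup B S ≤ GL(V)` of a subset `S` (alternating `B`):
every element fixes the radical `ker B` pointwise (`localTubeSpan_transvectionGroup_apply_of_mem_ker`),
is an isometry (`localTubeSpan_transvectionGroup_isometry`), preserves the lattice `ℤΔ` when `B` is
integral on `Δ` (`localTubeSpan_transvectionGroup_map_span_int`) and the span `ℚS`
(`localTubeSpan_transvectionGroup_map_span`); plus four one-line identities for units of `End V`.

No named facts; no `sorry`.
-/

-- `Summit.HodgeConjecture.HodgeConjecture.Theorems` is the mandated namespace (single-conjunct summit:
-- Sub = Summit), which `linter.dupNamespace` flags on every declaration; the lakefile turns the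
-- linter off tree-wide (weak option), restated here so stand-alone elaboration is warning-free too.
set_option linter.dupNamespace false

noncomputable section

open Literature.AlgebraicGeometry.HodgeTheory

namespace Summit.HodgeConjecture.HodgeConjecture.Theorems

/-! ### Elements of a transvection group: radical, isometry, lattice, span -/

section Basic

variable {V : Type*} [AddCommGroup V] [Module ℚ V] (B : LinearMap.BilinForm ℚ V)

/-- `a (a⁻¹ x) = x` for a unit of `End V`. [folklore] -/
theorem localTubeSpan_units_apply_inv_apply (a : (V →ₗ[ℚ] V)ˣ) (x : V) :
    (a : V →ₗ[ℚ] V) (((a⁻¹ : (V →ₗ[ℚ] V)ˣ) : V →ₗ[ℚ] V) x) = x := by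
  rw [← Module.End.mul_apply, ← Units.val_mul, mul_inv_cancel, Units.val_one, Module.End.one_apply]

/-- `a⁻¹ (a x) = x` for a unit of `End V`. [folklore] -/
theorem localTubeSpan_units_inv_apply_apply (a : (V →ₗ[ℚ] V)ˣ) (x : V) :
    ((a⁻¹ : (V →ₗ[ℚ] V)ˣ) : V →ₗ[ℚ] V) ((a : V →ₗ[ℚ] V) x) = x := by
  rw [← Module.End.mul_apply, ← Units.val_mul, inv_mul_cancel, Units.val_one, Module.End.one_apply]

/-- `(a⁻¹ g) x - x = a⁻¹ (g x - a x)` for units of `End V`. [folklore] -/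
theorem localTubeSpan_units_inv_mul_apply_sub (a g : (V →ₗ[ℚ] V)ˣ) (x : V) :
    ((a⁻¹ * g : (V →ₗ[ℚ] V)ˣ) : V →ₗ[ℚ] V) x - x =
      ((a⁻¹ : (V →ₗ[ℚ] V)ˣ) : V →ₗ[ℚ] V) ((g : V →ₗ[ℚ] V) x - (a : V →ₗ[ℚ] V) x) := by
  rw [Units.val_mul, Module.End.mul_apply, map_sub, localTubeSpan_units_inv_apply_apply]

/-- `(g n g⁻¹) x - x = g (n (g⁻¹ x) - g⁻¹ x)` for units of `End V`. [folklore] -/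
theorem localTubeSpan_units_conj_apply_sub (g n : (V →ₗ[ℚ] V)ˣ) (x : V) :
    ((g * n * g⁻¹ : (V →ₗ[ℚ] V)ˣ) : V →ₗ[ℚ] V) x - x =
      (g : V →ₗ[ℚ] V) (((n : (V →ₗ[ℚ] V)ˣ) : V →ₗ[ℚ] V) (((g⁻¹ : (V →ₗ[ℚ] V)ˣ) : V →ₗ[ℚ] V) x) -
        ((g⁻¹ : (V →ₗ[ℚ] V)ˣ) : V →ₗ[ℚ] V) x) := by
  rw [map_sub, localTubeSpan_units_apply_inv_apply, Units.val_mul, Units.val_mul,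
    Module.End.mul_apply, Module.End.mul_apply]

/-- Every element of `Γ_S` fixes the radical `ker B` pointwise (`T_δ r = r - B(r, δ) δ = r`).
[folklore] -/
theorem localTubeSpan_transvectionGroup_apply_of_mem_ker (hB : B.IsAlt) (S : Set V)
    {g : (V →ₗ[ℚ] V)ˣ} (hg : g ∈ transvectionGroup B S) {r : V} (hr : r ∈ LinearMap.ker B) :
    (g : V →ₗ[ℚ] V) r = r := by
  have hr0 : ∀ δ : V, B r δ = 0 := fun δ => by
    rw [LinearMap.mem_ker] at hr
    rw [hr, LinearMap.zero_apply]
  unfold transvectionGroup at hg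
  induction hg using Subgroup.closure_induction'' with
  | mem u hu =>
    obtain ⟨δ, -, hu⟩ := hu
    rw [hu, skewTransvection_apply, hr0, zero_smul, sub_zero]
  | inv_mem u hu =>
    obtain ⟨δ, -, hu⟩ := hu
    rw [localTubeSpan_unit_inv_apply B hu (hB.self_eq_zero δ), hr0, zero_smul, add_zero]
  | one => rw [Units.val_one, Module.End.one_apply]
  | mul g h _ _ ihg ihh => rw [Units.val_mul, Module.End.mul_apply, ihh, ihg]

/-- Every element of `Γ_S` is an isometry of the alternating form `B`. [folklore] -/
theorem localTubeSpan_transvectionGroup_isometry (hB : B.IsAlt) (S : Set V)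
    {g : (V →ₗ[ℚ] V)ˣ} (hg : g ∈ transvectionGroup B S) (x y : V) :
    B ((g : V →ₗ[ℚ] V) x) ((g : V →ₗ[ℚ] V) y) = B x y := by
  unfold transvectionGroup at hg
  induction hg using Subgroup.closure_induction'' generalizing x y with
  | mem u hu =>
    obtain ⟨δ, -, hu⟩ := hu
    refine localTubeSpan_isometry_of_transvection_formula B hB δ _ (fun z => ?_) x y
    rw [hu, skewTransvection_apply]
  | inv_mem u hu =>
    obtain ⟨δ, -, hu⟩ := hu
    have hisou : ∀ a b, B ((u : V →ₗ[ℚ] V) a) ((u : V →ₗ[ℚ] V) b) = B a b := fun a b =>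
      localTubeSpan_isometry_of_transvection_formula B hB δ _
        (fun z => by rw [hu, skewTransvection_apply]) a b
    rw [← hisou, localTubeSpan_units_apply_inv_apply, localTubeSpan_units_apply_inv_apply]
  | one => rw [Units.val_one, Module.End.one_apply, Module.End.one_apply]
  | mul g h _ _ ihg ihh => rw [Units.val_mul, Module.End.mul_apply, Module.End.mul_apply, ihg, ihh]

/-- Every element of `Γ_Δ` preserves the lattice `ℤΔ` when `B` is integral on `Δ`. [folklore] -/
theorem localTubeSpan_transvectionGroup_map_span_int (hB : B.IsAlt) (Δ : Set V)
    (hint : ∀ δ ∈ Δ, ∀ δ' ∈ Δ, ∃ n : ℤ, B δ δ' = n)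
    {g : (V →ₗ[ℚ] V)ˣ} (hg : g ∈ transvectionGroup B Δ) {x : V}
    (hx : x ∈ Submodule.span ℤ Δ) : (g : V →ₗ[ℚ] V) x ∈ Submodule.span ℤ Δ := by
  unfold transvectionGroup at hg
  induction hg using Subgroup.closure_induction'' generalizing x with
  | mem u hu =>
    obtain ⟨δ, hδ, hu⟩ := hu
    obtain ⟨n, hn⟩ := localTubeSpan_exists_int_eq_of_mem_span_int B Δ δ
      (fun y hy => hint y hy δ hδ) hx
    rw [hu, skewTransvection_apply, hn, Int.cast_smul_eq_zsmul]
    exact Submodule.sub_mem _ hx (Submodule.smul_mem _ _ (Submodule.subset_span hδ))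
  | inv_mem u hu =>
    obtain ⟨δ, hδ, hu⟩ := hu
    obtain ⟨n, hn⟩ := localTubeSpan_exists_int_eq_of_mem_span_int B Δ δ
      (fun y hy => hint y hy δ hδ) hx
    rw [localTubeSpan_unit_inv_apply B hu (hB.self_eq_zero δ), hn, Int.cast_smul_eq_zsmul]
    exact Submodule.add_mem _ hx (Submodule.smul_mem _ _ (Submodule.subset_span hδ))
  | one => rwa [Units.val_one, Module.End.one_apply]
  | mul g h _ _ ihg ihh =>
    rw [Units.val_mul, Module.End.mul_apply]
    exact ihg (ihh hx)

/-- Every element of `Γ_S` preserves the span `ℚS`. [folklore] -/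
theorem localTubeSpan_transvectionGroup_map_span (hB : B.IsAlt) (S : Set V)
    {g : (V →ₗ[ℚ] V)ˣ} (hg : g ∈ transvectionGroup B S) {x : V}
    (hx : x ∈ Submodule.span ℚ S) : (g : V →ₗ[ℚ] V) x ∈ Submodule.span ℚ S := by
  unfold transvectionGroup at hg
  induction hg using Subgroup.closure_induction'' generalizing x with
  | mem u hu =>
    obtain ⟨δ, hδ, hu⟩ := hu
    rw [hu, skewTransvection_apply]
    exact Submodule.sub_mem _ hx (Submodule.smul_mem _ _ (Submodule.subset_span hδ))
  | inv_mem u hu =>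
    obtain ⟨δ, hδ, hu⟩ := hu
    rw [localTubeSpan_unit_inv_apply B hu (hB.self_eq_zero δ)]
    exact Submodule.add_mem _ hx (Submodule.smul_mem _ _ (Submodule.subset_span hδ))
  | one => rwa [Units.val_one, Module.End.one_apply]
  | mul g h _ _ ihg ihh =>
    rw [Units.val_mul, Module.End.mul_apply]
    exact ihg (ihh hx)

end Basic

end Summit.HodgeConjecture.HodgeConjecture.Theorems

end
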